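import Summits.Schanuel.Schanuel.Theorems.RootDecomp1KTwoBaseCell04

/-!
# RootDecomp1KTwoBaseCell — lens 1, generation 36 «TWO-BASE WALL CELL of 33364» (RootDecomp1KTwoBaseCell.lean f6aad3c3…, 1847 l) — continuation (RootDecomp1KTwoBaseCell05): §5 named forms of the engine, suppliers, Schanuel's bound on the multi-base cells (`sb_threeBaseCell_pi`, `weights_b23_injective`, `wt_b24_not_injective`)

(lens-1 g36 `RootDecomp1KTwoBaseCell.lean`, sha256 f6aad3c3…cd39, own farm rc 0 · 0 sorry · axioms std; critic VERDICT STATUS L1729 PORT GO LOW;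
port by census-1 gen 15 in nine parts `RootDecomp1KTwoBaseCell01`–`09` — see the PORT NOTE of part 01; `--supports stmt-Schanuel-33364`; rung 0.)
-/

noncomputable section

open Complex IntermediateField Polynomial
open Summit.Schanuel.Schanuel.Theorems.RootDecomp1KHyper
open Summit.Schanuel.Schanuel.Theorems.RootDecomp1KHyper.HyperCell
open Summit.Schanuel.Schanuel.Theorems.RootDecomp1KGeneric
open Summit.Schanuel.Schanuel.Theorems.RootDecomp1KRelLiouvilleCell
open Summit.Schanuel.Schanuel.Theorems.RootDecomp1KLogLogCell (LogLogLiouville logLogLiouville_of_logSqLiouville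
  logLogLiouville_of_logHyperLiouville logLogLiouville_of_hyperLiouville)

namespace Summit.Schanuel.Schanuel.Theorems.RootDecomp1KTwoBaseCell

open LiouvilleNumber
open scoped Nat

/-! ## §5  The named forms of the engine, suppliers, and Schanuel's bound on the multi-base cells -/

section Suppliers
open LiouvilleNumber
open scoped Nat

variable {k n : ℕ}

/-- **(L)** the lacunary non-vanishing lemma under the critic's name: ANY degree, NO minimality / irreducibility
hypothesis on `q` (the load-bearing delta against the Adams / Bundschuh–Wylegala criteria). -/
theorem lacunary_eval_ne_zero_eventually {b : Fin k → ℕ} (hb : ∀ i, 2 ≤ b i)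
    (hinj : Function.Injective fun m : Fin k →₀ ℕ => ∏ i, b i ^ m i) (q : MvPolynomial (Fin k) ℝ)
    (hq : q ≠ 0) :
    ∃ N₀ : ℕ, ∀ N ≥ N₀, MvPolynomial.eval (fun i => partialSum (b i : ℝ) N) q ≠ 0 :=
  eventually_eval_partialSum_ne_zero hb hinj hq

/-- `Sum.elim u v ∘ finSumFinEquiv⁻¹ = Fin.append u v`. -/
private theorem sumElim_comp_finSumFinEquiv_symm {α : Type*} (u : Fin k → α) (v : Fin n → α) :
    Sum.elim u v ∘ finSumFinEquiv.symm = Fin.append u v := by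
  funext x
  refine Fin.addCases (fun i => ?_) (fun j => ?_) x
  · simp [finSumFinEquiv_symm_apply_castAdd, Fin.append_left]
  · simp [finSumFinEquiv_symm_apply_natAdd, Fin.append_right]

/-- **(X)** the engine in `Fin.append` form: `MvPolyMeasure θ` (tree class, FQ
`Summit.Schanuel.Schanuel.Theorems.RootDecomp1KHyper.MvPolyMeasure`) and injective weights give
`AlgebraicIndependent ℚ (ℓ_{b_1}, …, ℓ_{b_k}, θ)`. -/
theorem algebraicIndependent_lacunary_append {b : Fin k → ℕ} {θ : Fin n → ℂ}
    (hθ : Summit.Schanuel.Schanuel.Theorems.RootDecomp1KHyper.MvPolyMeasure θ) (hb : ∀ i, 2 ≤ b i)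
    (hinj : Function.Injective fun m : Fin k →₀ ℕ => ∏ i, b i ^ m i) :
    AlgebraicIndependent ℚ (Fin.append (fun i => ((liouvilleNumber (b i) : ℝ) : ℂ)) θ) := by
  rw [← sumElim_comp_finSumFinEquiv_symm]
  exact (algebraicIndependent_liouville_of_mvPolyMeasure hb hinj hθ).comp _ finSumFinEquiv.symm.injective

/-- CONTROL FACT: multiplicatively dependent bases `(2, 4)` have NON-injective weights (`2² = 4¹`), so the
engine's hypothesis `hinj` genuinely excludes them. -/
theorem wt_b24_not_injective : ¬ Function.Injective (wt ![2, 4]) := by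
  intro h
  have h1 : wt ![2, 4] (Finsupp.single 0 2) = wt ![2, 4] (Finsupp.single 1 1) := by
    simp [wt, Finsupp.single_apply]
  have h2 := Finsupp.ext_iff.mp (h h1) 0
  simp at h2

/-- The same in the raw form of the cell theorems' hypothesis `hinj`. -/
theorem weights_b24_not_injective :
    ¬ Function.Injective (fun m : Fin 2 →₀ ℕ => ∏ i, (![2, 4] : Fin 2 → ℕ) i ^ m i) :=
  wt_b24_not_injective

/-- … whereas the engine's hypotheses HOLD for `(2, 3)` and `(2, 3, 5)`. -/
theorem weights_b23_injective :
    Function.Injective (fun m : Fin 2 →₀ ℕ => ∏ i, (![2, 3] : Fin 2 → ℕ) i ^ m i) :=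
  wt_b23_injective

/-- The bases `(2, 3, 5)`. -/
def b235 : Fin 3 → ℕ := ![2, 3, 5]

/-- The bases `(2, 3, 5)` are `≥ 2`. -/
theorem two_le_b235 : ∀ i, 2 ≤ b235 i := by
  intro i; fin_cases i <;> simp [b235]

/-- The bases `(2, 3, 5)` are pairwise coprime. -/
theorem b235_pairwise_coprime : ∀ i j : Fin 3, i ≠ j → Nat.Coprime (b235 i) (b235 j) := by
  decide

/-- Monomial weights for the bases `(2, 3, 5)` are injective. -/
theorem wt_b235_injective : Function.Injective (wt b235) :=
  wt_injective_of_pairwise_coprime two_le_b235 b235_pairwise_coprime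

/-- **Schanuel's bound on the multi-base cell `(1, ℓ_{b_1}, …, ℓ_{b_k})`, e-version** (mod `hNW : NWMeasure` BY
NAME; `e = exp 1` is the `θ` of the engine, its measure `polyMeasure_exp_one_of_NW hNW` →
`mvPolyMeasure_one_of_polyMeasure`, tree). -/
theorem sb_multiBaseCell (hNW : NWMeasure) {b : Fin k → ℕ} (hb : ∀ i, 2 ≤ b i)
    (hinj : Function.Injective fun m : Fin k →₀ ℕ => ∏ i, b i ^ m i) :
    SB (k + 1) (Fin.cons (1 : ℂ) (fun i => ((liouvilleNumber (b i) : ℝ) : ℂ))) := by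
  have hai := algebraicIndependent_liouville_of_mvPolyMeasure hb hinj
    (mvPolyMeasure_one_of_polyMeasure (polyMeasure_exp_one_of_NW hNW))
  refine sb_of_algebraicIndependent hai (by simp) ?_
  intro x
  rcases x with i | j
  · simp only [Sum.elim_inl]
    exact subset_adjoin ℚ _ (Or.inl (Or.inl ⟨i.succ, by simp⟩))
  · simp only [Sum.elim_inr]
    refine subset_adjoin ℚ _ (Or.inl (Or.inr ⟨0, ?_⟩))
    fin_cases j
    simp

/-- **Schanuel's bound on the multi-base cell, π-version `(π, πℓ_{b_1}, …, πℓ_{b_k})` — HYPOTHESIS-FREE**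
(`θ = π`, tree-proved `polyMeasure_pi`; `ℓ_{b_i} = z_{i+1}/z_0`). -/
theorem sb_multiBaseCell_pi {b : Fin k → ℕ} (hb : ∀ i, 2 ≤ b i)
    (hinj : Function.Injective fun m : Fin k →₀ ℕ => ∏ i, b i ^ m i) :
    SB (k + 1) (Fin.cons (Real.pi : ℂ) (fun i => (Real.pi : ℂ) * ((liouvilleNumber (b i) : ℝ) : ℂ))) := by
  set z : Fin (k + 1) → ℂ :=
    Fin.cons (Real.pi : ℂ) (fun i => (Real.pi : ℂ) * ((liouvilleNumber (b i) : ℝ) : ℂ)) with hz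
  have hπ0 : (Real.pi : ℂ) ≠ 0 := by exact_mod_cast Real.pi_ne_zero
  have hz0 : z 0 ∈ adjoin ℚ (SFset z ∪ {I}) := subset_adjoin ℚ _ (Or.inl (Or.inl ⟨0, rfl⟩))
  have hzs : ∀ i : Fin k, z i.succ ∈ adjoin ℚ (SFset z ∪ {I}) := fun i =>
    subset_adjoin ℚ _ (Or.inl (Or.inl ⟨i.succ, rfl⟩))
  have ez0 : z 0 = (Real.pi : ℂ) := by simp [hz]
  have ezs : ∀ i : Fin k, z i.succ = (Real.pi : ℂ) * ((liouvilleNumber (b i) : ℝ) : ℂ) := fun i => by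
    simp [hz]
  have hai := algebraicIndependent_liouville_of_mvPolyMeasure hb hinj
    (mvPolyMeasure_one_of_polyMeasure polyMeasure_pi)
  refine sb_of_algebraicIndependent hai (by simp) ?_
  intro x
  rcases x with i | j
  · simp only [Sum.elim_inl]
    have e : ((liouvilleNumber (b i) : ℝ) : ℂ) = z i.succ / z 0 := by
      rw [ezs, ez0, mul_div_cancel_left₀ _ hπ0]
    rw [e]; exact div_mem (hzs i) hz0
  · simp only [Sum.elim_inr]
    have e : (![(Real.pi : ℂ)] : Fin 1 → ℂ) j = z 0 := by fin_cases j; simp [ez0]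
    rw [e]; exact hz0

/-- **Schanuel's bound on the TWO-BASE WALL CELL `(1, ℓ₂, ℓ₃)`** (mod `hNW` only). -/
theorem sb_twoBaseCell (hNW : NWMeasure) :
    SB 3 ![(1 : ℂ), ((liouvilleNumber 2 : ℝ) : ℂ), ((liouvilleNumber 3 : ℝ) : ℂ)] := by
  have e : (Fin.cons (1 : ℂ) (fun i => ((liouvilleNumber (b23 i) : ℝ) : ℂ)) : Fin 3 → ℂ) =
      ![(1 : ℂ), ((liouvilleNumber 2 : ℝ) : ℂ), ((liouvilleNumber 3 : ℝ) : ℂ)] := by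
    funext i
    refine Fin.cases ?_ (fun j => ?_) i
    · simp
    · simp only [Fin.cons_succ, Matrix.cons_val_succ]
      fin_cases j <;> simp [b23]
  have h := sb_multiBaseCell hNW two_le_b23 wt_b23_injective
  rw [e] at h
  exact h

/-- **Schanuel's bound on the π-twin `(π, πℓ₂, πℓ₃)` — HYPOTHESIS-FREE.** -/
theorem sb_twoBaseCell_pi :
    SB 3 ![(Real.pi : ℂ), (Real.pi : ℂ) * ((liouvilleNumber 2 : ℝ) : ℂ),
      (Real.pi : ℂ) * ((liouvilleNumber 3 : ℝ) : ℂ)] := by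
  have e : (Fin.cons (Real.pi : ℂ) (fun i => (Real.pi : ℂ) * ((liouvilleNumber (b23 i) : ℝ) : ℂ)) :
      Fin 3 → ℂ) = ![(Real.pi : ℂ), (Real.pi : ℂ) * ((liouvilleNumber 2 : ℝ) : ℂ),
        (Real.pi : ℂ) * ((liouvilleNumber 3 : ℝ) : ℂ)] := by
    funext i
    refine Fin.cases ?_ (fun j => ?_) i
    · simp
    · simp only [Fin.cons_succ, Matrix.cons_val_succ]
      fin_cases j <;> simp [b23]
  have h := sb_multiBaseCell_pi two_le_b23 wt_b23_injective
  rw [e] at h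
  exact h

/-- **Schanuel's bound on the THREE-BASE cell `(π, πℓ₂, πℓ₃, πℓ₅)` — HYPOTHESIS-FREE** (a `k ≥ 3` instance). -/
theorem sb_threeBaseCell_pi :
    SB 4 ![(Real.pi : ℂ), (Real.pi : ℂ) * ((liouvilleNumber 2 : ℝ) : ℂ),
      (Real.pi : ℂ) * ((liouvilleNumber 3 : ℝ) : ℂ), (Real.pi : ℂ) * ((liouvilleNumber 5 : ℝ) : ℂ)] := by
  have e : (Fin.cons (Real.pi : ℂ) (fun i => (Real.pi : ℂ) * ((liouvilleNumber (b235 i) : ℝ) : ℂ)) :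
      Fin 4 → ℂ) = ![(Real.pi : ℂ), (Real.pi : ℂ) * ((liouvilleNumber 2 : ℝ) : ℂ),
        (Real.pi : ℂ) * ((liouvilleNumber 3 : ℝ) : ℂ), (Real.pi : ℂ) * ((liouvilleNumber 5 : ℝ) : ℂ)] := by
    funext i
    refine Fin.cases ?_ (fun j => ?_) i
    · simp
    · simp only [Fin.cons_succ, Matrix.cons_val_succ]
      fin_cases j <;> simp [b235]
  have h := sb_multiBaseCell_pi two_le_b235 wt_b235_injective
  rw [e] at h
  exact h

end Suppliers

end Summit.Schanuel.Schanuel.Theorems.RootDecomp1KTwoBaseCell
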